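import Summits.CriticalPhenomena.CardyFormulaZ2.Theorems.CardyMagicRigidityMarkovCascadeDefs
import Literature.Probability.Percolation.FKLoopNestingIntegrable
import Literature.Probability.LatticeModels.TriangularLatticeProofs
import HarnessLib

/-!
# Honesty of the closed-b.c. domain ensembles at fixed mesh (line `markov-cascade-one-generation`, crux `NestingRigidity`)

Crux `Summit.CriticalPhenomena.CardyFormulaZ2.Theses.CardyMagicRigidity.NestingRigidity`
(stmt-CriticalPhenomena-4835), line `markov-cascade-one-generation`; helper lemmas toward stub
`stub_kernelUniqueness : KernelUniqueness` (S4) and its neighbours over the definitions module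
`CardyMagicRigidityMarkovCascadeDefs` (`firstGen`, `meshEdges`, `domLoopsZ2/T`, `domTransformZ2/T`).
Everything here is closed (no hypothesis of the crux):

* §3 the first generation `firstGen c`: outermost loops are loops of the same type; in a configuration
  with finitely many loops EVERY loop is nested (hole-wise) in a first-generation loop
  (`exists_mem_firstGen_holeOf_subset`, no non-crossing needed), and in a laminar configuration two
  first-generation loops have equal or disjoint holes;
* §4 honesty of the domain transforms at fixed mesh `δ > 0` in a bounded domain `U` (the holes
  `holeOf (uδ δ)` of the line are bounded, `isBounded_holeOf` in the companion file
  `…NestingRigidityHoleGeometry`): `meshEdges U δ` is finite, both domain ensembles read finitely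
  many edges / sites (`domLoopsZ2_inter_meshEdges`, `domLoopsT_inter_triMeshVertices`), every
  function of finitely many coordinates of a random set is measurable and integrable under a finite
  measure (`integrable_comp_inter_of_finite`), hence EVERY function
  of either domain ensemble is a measurable function of the configuration and both domain nesting
  weights are integrable (`integrable_nestingWeight_domLoopsZ2/T`): the Bochner integrals
  `domTransformZ2/T` of `DomainTransfer` are genuine expectations, never the junk value `0`; the
  `ℤ²` ensemble has finitely many loops (`loops_domLoopsZ2_finite`), `|A_f| ≤ 2^{#loops}`, and the
  zero test function (admissible in every loop) has transform `1` on both lattices.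
-/

noncomputable section

open MeasureTheory Set Filter
open scoped Topology BigOperators ENNReal Real

namespace Summit.CriticalPhenomena.CardyFormulaZ2.Cruxes.NestingRigidity.MarkovCascadeOneGeneration

open Literature.Probability.RandomPlanarGeometry Literature.Probability.Percolation
  Literature.Probability.LatticeModels

/-! ## §3 The first generation -/

/-- Outermost loops of type `i` are loops of type `i`. -/
theorem firstGen_F_subset (c : LoopConfig ℂ) (i : Fin 2) : (firstGen c).F i ⊆ c.F i :=
  fun _ hu ↦ hu.1

/-- Membership in the first generation, unfolded: a loop of type `i` whose hole is not strictly
inside the hole of another loop of the configuration. -/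
theorem mem_firstGen_F_iff {c : LoopConfig ℂ} {i : Fin 2} {u : UnbasedLoop ℂ} :
    u ∈ (firstGen c).F i ↔ u ∈ c.F i ∧ ∀ v ∈ c.loops, ¬ (holeOf u ⊂ holeOf v) := Iff.rfl

/-- Outermost loops are loops. -/
theorem loops_firstGen_subset (c : LoopConfig ℂ) : (firstGen c).loops ⊆ c.loops := by
  intro u hu
  rcases LoopConfig.mem_loops_iff.1 hu with h | h
  · exact LoopConfig.mem_loops_iff.2 (Or.inl (firstGen_F_subset c 0 h))
  · exact LoopConfig.mem_loops_iff.2 (Or.inr (firstGen_F_subset c 1 h))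

/-- Membership in the set of all first-generation loops. -/
theorem mem_loops_firstGen_iff {c : LoopConfig ℂ} {u : UnbasedLoop ℂ} :
    u ∈ (firstGen c).loops ↔ u ∈ c.loops ∧ ∀ v ∈ c.loops, ¬ (holeOf u ⊂ holeOf v) := by
  simp only [LoopConfig.mem_loops_iff, mem_firstGen_F_iff]
  tauto

/-- A loop whose hole is maximal among the holes of the configuration is first generation. -/
theorem mem_firstGen_F_of_forall_not_ssubset {c : LoopConfig ℂ} {i : Fin 2} {u : UnbasedLoop ℂ}
    (hu : u ∈ c.F i) (h : ∀ v ∈ c.loops, holeOf u ⊆ holeOf v → holeOf v ⊆ holeOf u) :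
    u ∈ (firstGen c).F i :=
  ⟨hu, fun v hv hss ↦ hss.2 (h v hv hss.1)⟩

/-- The empty configuration has empty first generation, and conversely a configuration one of whose
families is empty has empty first generation of that type. -/
theorem firstGen_F_eq_empty {c : LoopConfig ℂ} {i : Fin 2} (h : c.F i = ∅) : (firstGen c).F i = ∅ :=
  Set.subset_eq_empty (firstGen_F_subset c i) h

/-- **Every loop of a configuration with finitely many loops is nested, hole-wise, inside a
first-generation loop** (possibly itself): a hole-maximal element of the finite set of loops whose
holes contain `holeOf u` is first generation. No non-crossing hypothesis is needed. This is the
statement that lets the cascade of `stub_cascadeReconstruction` exhaust all loops generation by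
generation. -/
theorem exists_mem_firstGen_holeOf_subset : ∀ {c : LoopConfig ℂ}, c.loops.Finite →
    ∀ {u : UnbasedLoop ℂ}, u ∈ c.loops → ∃ v ∈ (firstGen c).loops, holeOf u ⊆ holeOf v := by
  intro c hc u hu
  set S : Set (UnbasedLoop ℂ) := {v ∈ c.loops | holeOf u ⊆ holeOf v} with hS
  have hSfin : S.Finite := hc.subset (sep_subset _ _)
  obtain ⟨v, hv, hmax⟩ := hSfin.exists_maximalFor holeOf S ⟨u, hu, subset_rfl⟩
  refine ⟨v, mem_loops_firstGen_iff.2 ⟨hv.1, fun w hw hss ↦ ?_⟩, hv.2⟩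
  have hwS : w ∈ S := ⟨hw, hv.2.trans hss.1⟩
  exact hss.2 (hmax hwS (show holeOf v ≤ holeOf w from hss.1))

/-- **In a laminar configuration the first generation is an antichain**: if the holes of the loops
are pairwise nested or disjoint (non-crossing loops: the lattice ensembles and their limits), two
first-generation loops have equal or disjoint holes. -/
theorem holeOf_eq_or_disjoint_of_mem_firstGen {c : LoopConfig ℂ}
    (hlam : ∀ u ∈ c.loops, ∀ v ∈ c.loops,
      holeOf u ⊆ holeOf v ∨ holeOf v ⊆ holeOf u ∨ Disjoint (holeOf u) (holeOf v))
    {u v : UnbasedLoop ℂ} (hu : u ∈ (firstGen c).loops) (hv : v ∈ (firstGen c).loops) :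
    holeOf u = holeOf v ∨ Disjoint (holeOf u) (holeOf v) := by
  rw [mem_loops_firstGen_iff] at hu hv
  rcases hlam u hu.1 v hv.1 with h | h | h
  · by_cases he : holeOf u = holeOf v
    · exact Or.inl he
    · exact absurd (Set.ssubset_iff_subset_ne.2 ⟨h, he⟩) (hu.2 v hv.1)
  · by_cases he : holeOf u = holeOf v
    · exact Or.inl he
    · exact absurd (Set.ssubset_iff_subset_ne.2 ⟨h, Ne.symm he⟩) (hv.2 u hu.1)
  · exact Or.inr h

/-! ## §4 Finitely many edges / sites are read: the domain transforms are honest at fixed mesh -/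

/-- `meshEdges U δ` consists of unordered pairs of mesh vertices of `U`. -/
theorem meshEdges_subset_image (U : Set ℂ) (δ : ℝ) :
    meshEdges U δ ⊆ (fun p : Site 2 × Site 2 ↦ s(p.1, p.2)) '' (meshVertices U δ ×ˢ meshVertices U δ) := by
  intro e he
  induction e using Sym2.ind with
  | _ a b =>
    exact ⟨(a, b), ⟨he a (Sym2.mem_mk_left a b), he b (Sym2.mem_mk_right a b)⟩, rfl⟩

/-- **For bounded `U` and `δ > 0` only finitely many edges of `δℤ²` lie in `U`.** -/
theorem meshEdges_finite : ∀ {U : Set ℂ}, Bornology.IsBounded U → ∀ {δ : ℝ}, 0 < δ →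
    (meshEdges U δ).Finite := fun {U} hU {δ} hδ ↦
  (((meshVertices_finite hU hδ).prod (meshVertices_finite hU hδ)).image _).subset
    (meshEdges_subset_image U δ)

/-- The `ℤ²` domain ensemble reads the configuration only on `meshEdges U δ`. -/
theorem domLoopsZ2_inter_meshEdges (U : Set ℂ) (δ : ℝ) (ω : BondConfig (Site 2)) :
    domLoopsZ2 U δ (ω ∩ meshEdges U δ) = domLoopsZ2 U δ ω := by
  unfold domLoopsZ2
  simp only [Set.inter_assoc, Set.inter_self]

/-- The `𝕋` domain ensemble reads the configuration only on `triMeshVertices U δ`. -/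
theorem domLoopsT_inter_triMeshVertices (U : Set ℂ) (δ : ℝ) (ω : SiteConfig (Site 2)) :
    domLoopsT U δ (ω ∩ triMeshVertices U δ) = domLoopsT U δ ω := by
  unfold domLoopsT
  rw [Set.inter_assoc, Set.inter_self]

/-- The medial point of every entry of a dart list lies on its polyline at angle `0`. -/
theorem medialPoint_mem_range_loopCurve_zero (δ : ℝ) {γ : List MedialVertex} {e : MedialVertex}
    (he : e ∈ γ) : medialPoint δ e ∈ (loopCurve δ 0 γ).range := by
  simpa using mem_range_loopCurve δ 0 he

/-- An edge of `U_δ` has its medial point in every closed ball about `0` containing `U` (midpoint of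
two points of the ball). -/
theorem medialPoint_mem_closedBall_of_mem_meshEdges {U : Set ℂ} {R : ℝ}
    (hU : U ⊆ Metric.closedBall 0 R) {δ : ℝ} {e : Sym2 (Site 2)} (he : e ∈ meshEdges U δ) :
    medialPoint δ e ∈ Metric.closedBall (0 : ℂ) R := by
  induction e using Sym2.ind with
  | _ a b =>
    have ha := hU (he a (Sym2.mem_mk_left a b))
    have hb := hU (he b (Sym2.mem_mk_right a b))
    rw [Metric.mem_closedBall, dist_zero_right] at ha hb ⊢
    rw [medialPoint_mk, norm_div, Complex.norm_ofNat]
    linarith [norm_add_le (meshPoint δ a) (meshPoint δ b)]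

/-- **The `ℤ²` domain ensemble of a bounded domain has finitely many loops at every mesh `δ > 0`**:
each of its loops passes through the medial point of an edge of `U_δ`, hence meets a fixed closed
ball, and only finitely many loops of a configuration do (`ncard_loops_meeting_le`). -/
theorem loops_domLoopsZ2_finite : ∀ {U : Set ℂ}, Bornology.IsBounded U → ∀ {δ : ℝ}, 0 < δ →
    ∀ ω : BondConfig (Site 2), (domLoopsZ2 U δ ω).loops.Finite := by
  intro U hU δ hδ ω
  obtain ⟨R, hR⟩ := hU.subset_closedBall 0
  refine (ncard_loops_meeting_le hδ R (ω ∩ meshEdges U δ)).1.subset fun u hu ↦ ?_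
  have key : ∀ i : Fin 2, u ∈ (domLoopsZ2 U δ ω).F i →
      u ∈ (bondLoopConfig δ 0 (ω ∩ meshEdges U δ)).F i ∧
        (u.range ∩ Metric.closedBall (0 : ℂ) R).Nonempty := by
    intro i hui
    refine ⟨domLoopsZ2_subset U δ ω i hui, ?_⟩
    obtain ⟨γ, h, -, ⟨e, heγ, heM⟩, rfl⟩ := hui
    refine ⟨medialPoint δ e, ?_, medialPoint_mem_closedBall_of_mem_meshEdges hR heM⟩
    rw [UnbasedLoop.range_mk, BasedLoop.toCurveClass_mk]
    exact medialPoint_mem_range_loopCurve_zero δ heγ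
  rcases LoopConfig.mem_loops_iff.1 hu with h0 | h1
  · exact ⟨Or.inl (key 0 h0).1, (key 0 h0).2⟩
  · exact ⟨Or.inr (key 1 h1).1, (key 1 h1).2⟩

/-- **`|A_f(c)| ≤ 2^{#loops}`** for a configuration with finitely many loops (each factor
`2cos(·)` has modulus `≤ 2`). -/
theorem abs_nestingWeight_le_two_pow (f : ℂ → ℝ) {c : LoopConfig ℂ} (hc : c.loops.Finite) :
    |c.nestingWeight f| ≤ 2 ^ c.loops.ncard := by
  rw [LoopConfig.nestingWeight, finprod_mem_eq_finite_toFinset_prod _ hc, Finset.abs_prod,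
    Set.ncard_eq_toFinset_card c.loops hc, ← Finset.prod_const]
  exact Finset.prod_le_prod (fun _ _ ↦ abs_nonneg _) fun u _ ↦ UnbasedLoop.abs_nestingFactor_le f u

/-- Hence the `ℤ²` domain nesting weight of a bounded domain is bounded by `2^{#loops}` pointwise. -/
theorem abs_nestingWeight_domLoopsZ2_le {U : Set ℂ} (hU : Bornology.IsBounded U) {δ : ℝ}
    (hδ : 0 < δ) (ω : BondConfig (Site 2)) (f : ℂ → ℝ) :
    |(domLoopsZ2 U δ ω).nestingWeight f| ≤ 2 ^ (domLoopsZ2 U δ ω).loops.ncard :=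
  abs_nestingWeight_le_two_pow f (loops_domLoopsZ2_finite hU hδ ω)

/-- Every loop of the `ℤ²` domain ensemble of a bounded domain is nested (hole-wise) in a
first-generation loop of the ensemble. -/
theorem exists_mem_firstGen_domLoopsZ2 {U : Set ℂ} (hU : Bornology.IsBounded U) {δ : ℝ} (hδ : 0 < δ)
    {ω : BondConfig (Site 2)} {u : UnbasedLoop ℂ} (hu : u ∈ (domLoopsZ2 U δ ω).loops) :
    ∃ v ∈ (firstGen (domLoopsZ2 U δ ω)).loops, holeOf u ⊆ holeOf v :=
  exists_mem_firstGen_holeOf_subset (loops_domLoopsZ2_finite hU hδ ω) hu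

section Cylinder

variable {E β : Type*} [Countable E] [MeasurableSpace β]

/-- **A function of finitely many coordinates of a random set is measurable**: if `M` is finite,
`ω ↦ g (ω ∩ M)` is measurable for EVERY `g` (it factors through the countable discrete set of subsets
of `M`, on which every function is measurable; the membership events `{ω | e ∈ ω}` are measurable
for the product σ-algebra of `Set E`).  Private copy of the sibling file's
`measurable_comp_inter_of_finite` (`…OneGenerationTLocality`, line S2), kept local to avoid an
import cycle in the build queue. -/
private theorem measurable_comp_inter_of_finite_aux (g : Set E → β) {M : Set E} (hM : M.Finite) :
    Measurable fun ω : Set E ↦ g (ω ∩ M) := by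
  have hc : Set.Countable {A : Set E | A ⊆ M} := hM.finite_subsets.countable
  haveI := hc.to_subtype
  have hr : Measurable fun ω : Set E ↦ (⟨ω ∩ M, Set.inter_subset_right⟩ : {A : Set E | A ⊆ M}) := by
    refine Measurable.subtype_mk ?_
    exact measurable_set_iff.2 fun a ↦ (measurable_set_mem a).and measurable_const
  exact (measurable_of_countable fun A : {A : Set E | A ⊆ M} ↦ g A.1).comp hr

/-- **… and integrable under every finite measure** (it takes finitely many values, hence is
bounded). -/
theorem integrable_comp_inter_of_finite (μ : Measure (Set E)) [IsFiniteMeasure μ] (g : Set E → ℝ)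
    {M : Set E} (hM : M.Finite) : Integrable (fun ω : Set E ↦ g (ω ∩ M)) μ := by
  obtain ⟨C, hC⟩ := ((hM.finite_subsets.image fun A ↦ ‖g A‖)).bddAbove
  refine (integrable_const C).mono' (measurable_comp_inter_of_finite_aux g hM).aestronglyMeasurable
    (ae_of_all _ fun ω ↦ ?_)
  exact hC ⟨ω ∩ M, Set.inter_subset_right, rfl⟩

end Cylinder

/-- **Every function of the `ℤ²` domain ensemble is a measurable function of the configuration**
(bounded `U`, `δ > 0`): in particular indicators of `d_CN`-events of `firstGen ∘ domLoopsZ2 U δ` and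
the nesting weight. -/
theorem measurable_comp_domLoopsZ2 : ∀ {β : Type*} [MeasurableSpace β] (g : LoopConfig ℂ → β)
    {U : Set ℂ}, Bornology.IsBounded U → ∀ {δ : ℝ}, 0 < δ →
      Measurable fun ω ↦ g (domLoopsZ2 U δ ω) := by
  intro β _ g U hU δ hδ
  have h := measurable_comp_inter_of_finite_aux (fun ω ↦ g (domLoopsZ2 U δ ω)) (meshEdges_finite hU hδ)
  simpa only [domLoopsZ2_inter_meshEdges] using h

/-- The `𝕋` analogue of `measurable_comp_domLoopsZ2`. -/
theorem measurable_comp_domLoopsT : ∀ {β : Type*} [MeasurableSpace β] (g : LoopConfig ℂ → β)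
    {U : Set ℂ}, Bornology.IsBounded U → ∀ {δ : ℝ}, 0 < δ →
      Measurable fun ω ↦ g (domLoopsT U δ ω) := by
  intro β _ g U hU δ hδ
  have h := measurable_comp_inter_of_finite_aux (fun ω ↦ g (domLoopsT U δ ω))
    (triMeshVertices_finite_holds hU hδ)
  simpa only [domLoopsT_inter_triMeshVertices] using h

/-- **The `ℤ²` domain nesting weight is integrable at fixed mesh** (bounded `U`, `δ > 0`): the
closed-b.c. domain transform `domTransformZ2 U δ f = E[A_f(domLoopsZ2 U δ)]` is a genuine
expectation for EVERY test function `f`. -/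
theorem integrable_nestingWeight_domLoopsZ2 : ∀ {U : Set ℂ}, Bornology.IsBounded U → ∀ {δ : ℝ},
    0 < δ → ∀ f : ℂ → ℝ, Integrable (fun ω ↦ (domLoopsZ2 U δ ω).nestingWeight f) P2 := by
  intro U hU δ hδ f
  have h := integrable_comp_inter_of_finite P2 (fun ω ↦ (domLoopsZ2 U δ ω).nestingWeight f)
    (meshEdges_finite hU hδ)
  simpa only [domLoopsZ2_inter_meshEdges] using h

/-- **The `𝕋` domain nesting weight is integrable at fixed mesh** (bounded `U`, `δ > 0`). -/
theorem integrable_nestingWeight_domLoopsT : ∀ {U : Set ℂ}, Bornology.IsBounded U → ∀ {δ : ℝ},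
    0 < δ → ∀ f : ℂ → ℝ, Integrable (fun ω ↦ (domLoopsT U δ ω).nestingWeight f) PT := by
  intro U hU δ hδ f
  have h := integrable_comp_inter_of_finite PT (fun ω ↦ (domLoopsT U δ ω).nestingWeight f)
    (triMeshVertices_finite_holds hU hδ)
  simpa only [domLoopsT_inter_triMeshVertices] using h

/-- The zero test function has `ℤ²` domain transform `1` in every domain at every mesh (every loop
weighs `2cos(π/3) = 1`; `P2` is a probability measure). -/
@[simp] theorem domTransformZ2_zero : ∀ (U : Set ℂ) (δ : ℝ), domTransformZ2 U δ 0 = 1 := by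
  intro U δ
  simp [domTransformZ2, LoopConfig.nestingWeight]

/-- The zero test function has `𝕋` domain transform `1` in every domain at every mesh. -/
@[simp] theorem domTransformT_zero : ∀ (U : Set ℂ) (δ : ℝ), domTransformT U δ 0 = 1 := by
  intro U δ
  simp [domTransformT, LoopConfig.nestingWeight]

/-- Consistency of `DomainTransfer` at `f = 0` (which is admissible in every loop): the difference of
the two domain transforms vanishes identically. -/
theorem domTransformZ2_sub_domTransformT_zero (U : ℝ → Set ℂ) :
    Tendsto (fun δ : ℝ ↦ domTransformZ2 (U δ) δ 0 - domTransformT (U δ) δ 0) (𝓝[>] 0) (𝓝 0) := by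
  simp only [domTransformZ2_zero, domTransformT_zero, sub_self]
  exact tendsto_const_nhds

/-- The zero function is admissible in every loop. -/
theorem admissibleIn_zero (u : UnbasedLoop ℂ) : AdmissibleIn u 0 := by
  refine ⟨measurable_const, ⟨0, fun z ↦ by simp⟩, ?_, by simp⟩
  rw [show ((0 : ℂ → ℝ)) = fun _ ↦ (0 : ℝ) from rfl, tsupport]
  simp

end Summit.CriticalPhenomena.CardyFormulaZ2.Cruxes.NestingRigidity.MarkovCascadeOneGeneration

end
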